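import Summits.Langlands.Langlands.Theses.SqrtFiveQuarticCovers
import Literature.NumberTheory.Automorphic.TotallyRealModularityProofs
import Literature.NumberTheory.Automorphic.TotallyRealModularityQuarticDeductionProofs
import HarnessLib

/-!
# Route `SqrtFiveQuarticCovers` — support `BoxQuartic` (stmt-Langlands-17836) from Box's printed
# theorem (Box 2022, Thm. 1.1)

`Summit.Langlands.Langlands.Theses.SqrtFiveQuarticCovers.BoxQuartic` says: every elliptic curve
(`E / 𝓞 K`, `Δ ≠ 0`) over a totally real quartic field `K` NOT containing `√5`
(`¬ ∃ r : K, r ^ 2 = 5`) is modular (geometric CM, or a weight-zero cuspidal `π` of `GL₂(𝔸_K)`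
whose `T_w`-eigenvalue is `a_w(E)` at cofinitely many finite places `w` — the summit's cone, i.e.
`Literature.NumberTheory.Automorphic.IsModularEllipticCurve K E` written out).

This is VERBATIM the tree's named fact `Literature.NumberTheory.Automorphic.Box2022_theorem1_1`
(file `Literature/NumberTheory/Automorphic/TotallyRealModularity.lean`): J. Box, *Elliptic curves
over totally real quartic fields not containing `√5` are modular*, Trans. AMS 375 (2022) =
arXiv:2103.13975, Thm. 1.1 ("Let `E` be an elliptic curve over a totally real quartic number
field not containing a square root of `5`. Then `E` is modular."), in the Caraiani–Newton
rendering of "modular", through the proved bridge `Box2022_theorem1_1.isModularEllipticCurve`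
(`TotallyRealModularityProofs.lean`) and `¬ IsSquare (5 : K) ↔ ¬ ∃ r, r ^ 2 = 5`.

HONEST STATUS.  The theorem below is CONDITIONAL on that named fact (a published theorem, cited,
not proved in the tree): it takes `(h : Box2022_theorem1_1)`.  It is bookkeeping turning Box's
theorem, as vendored, into the route's binder `hB` of `closes`; nothing here proves modularity of
a new class of elliptic curves.

References: [Box2022] J. Box, Trans. AMS 375 (2022), doi:10.1090/tran/8557 = arXiv:2103.13975,
Thm. 1.1 (p. 3).
-/

noncomputable section

set_option linter.dupNamespace false -- project-wide option; `Summit.Langlands.Langlands` is the mandated namespace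

open scoped MatrixGroups NumberField
open NumberField
open Literature.NumberTheory.Automorphic Literature.NumberTheory.GaloisRepresentations
open Summit.Langlands.Langlands.Theses.SqrtFiveQuarticCovers

namespace Summit.Langlands.Langlands.Theorems

/-- **"`K` contains no square root of `5`"**: the route's rendering `¬ ∃ r : K, r ^ 2 = 5` gives
the Literature rendering `¬ IsSquare (5 : K)` of the hypothesis of Box 2022 Thm. 1.1.
[cite: Box2022, Thm. 1.1] -/
theorem not_isSquare_five_of_not_exists_sq {K : Type*} [Field K] (h5 : ¬ ∃ r : K, r ^ 2 = 5) :
    ¬ IsSquare (5 : K) := by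
  rintro ⟨r, hr⟩
  exact h5 ⟨r, by rw [sq]; exact hr.symm⟩

/-- **`BoxQuartic` from Box 2022 Thm. 1.1 (named fact `Box2022_theorem1_1`).**  Every elliptic
curve over a totally real quartic field not containing `√5` is modular in the route's written-out
sense: the fact gives `IsAutomorphicOfWeightZero E`, and `Box2022_theorem1_1.isModularEllipticCurve`
translates it into the cone (written out; closes by `δ`).  CONDITIONAL on the named fact (Box's
published theorem, cited not proved).  [cite: Box2022, Thm. 1.1 (p. 3)] -/
theorem BoxQuartic_of_Box2022_theorem1_1 (h : Box2022_theorem1_1) : BoxQuartic := by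
  intro K _ _ hK hd h5 E hE
  haveI : IsTotallyReal K := hK
  exact Box2022_theorem1_1.isModularEllipticCurve h K hd (not_isSquare_five_of_not_exists_sq h5) hE

/-! ## Appended 2026-08-30 (line `birth` of the crux, lead hand leafhand-…-2): `BoxQuartic` on the
finer printed trust base — Box's Thm. 1.1 is no longer an input but a consequence -/

/-- **`BoxQuartic` from Box 2022 Thm. 1.3 and Thm. 1.5** (named facts `Box2022_theorem1_3`,
`Box2022_theorem1_5_modular`, taken as hypotheses — CONDITIONAL): the composition of the line
`Cruxes/BoxQuartic/Lines/birth.lean` (stubs 1–2 = Thm. 1.3 (i),(iii) / (ii); stub 3 = Thm. 1.5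
with 1.4), through the Literature theorem `Box2022_theorem1_1_of_theorem1_3_of_theorem1_5` (the
printed §1.2 deduction, kernel-checked) and `BoxQuartic_of_Box2022_theorem1_1`.
[cite: Box2022, Thm. 1.1 and its proof, Thms. 1.3, 1.5] -/
theorem BoxQuartic_of_Box2022_theorem1_3_of_theorem1_5 (h13 : Box2022_theorem1_3)
    (h15 : Box2022_theorem1_5_modular) : BoxQuartic :=
  BoxQuartic_of_Box2022_theorem1_1 (Box2022_theorem1_1_of_theorem1_3_of_theorem1_5 h13 h15)

/-- **`BoxQuartic` from the five printed theorems behind Box's proof** — the four automorphy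
lifting theorems `FLS2015_theorem3` (Freitas–Le Hung–Siksek 2015, Thm. 3), `FLS2015_theorem4`
(ibid., Thm. 4), `Kalyanswamy2018_theorem1_2` (Kalyanswamy 2018, Thm. 1.2), (T) = Thorne 2016,
Thm. 7.5 (= Thm. 1.2) for `ρ_{E,p}` (hypothesis `hT`, written out verbatim as in
`Box2022_theorem1_3_of_fourLiftingTheorems`; it is the body of the named fact
`Thorne2016_theorem7_5_ellipticCurve`), and `Box2022_theorem1_5_modular` (Box 2022, Thm. 1.5 with
Thm. 1.4: the quartic points of the four `b5`-curves) — all taken as hypotheses, CONDITIONAL.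
Everything between these inputs and the crux (FLS Prop. 9.1 (a),(c), the Cartan-normaliser group
theory in `GL₂(𝔽₃)`, `GL₂(𝔽₇)`, `ζ₇ + ζ₇⁻¹ ∉ K` for quartic `K`, `√5 ∉ K ⇒ χ̄₅` onto, the §1.2
contradiction) is kernel-checked in the Literature (`Box2022_theorem1_1_of_liftingTheorems`).
This is the finest trust base the tree offers for stmt-Langlands-17836; none of the five inputs
has a carrier for its proof (Taylor–Wiles–Kisin patching; Chabauty and Mordell–Weil sieves).
[cite: Box2022, Thm. 1.1, Thms. 1.3–1.5] [cite: FreitasLeHungSiksek2015, Thms. 3–4, Prop. 9.1]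
[cite: Kalyanswamy2018, Thm. 1.2] [cite: Thorne2016, Thms. 7.5–7.6] -/
theorem BoxQuartic_of_liftingTheorems (h3 : FLS2015_theorem3) (h4 : FLS2015_theorem4)
    (hKal : Kalyanswamy2018_theorem1_2)
    (hT : ∀ (F : Type) [Field F] [NumberField F] [IsTotallyReal F] (p : ℕ) [Fact p.Prime], p ≠ 2 →
      ∀ (E : WeierstrassCurve (𝓞 F)), E.Δ ≠ 0 →
        ∀ ρ : ModPGaloisRep F (ZMod p) 2, (E.baseChange F).IsTorsionGaloisRep p ρ →
          FramedRep.IsAbsolutelyIrreducible ρ →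
          ∀ (L : Type) [Field L] [Algebra F L] [IsCyclotomicExtension {p} F L],
            (∃ (k : Type) (_ : Field k) (f : ZMod p →+* k) (Q : GL (Fin 2) k),
                (∀ τ : Field.absoluteGaloisGroup L,
                  Q * Matrix.GeneralLinearGroup.map f (FramedGaloisRep.restrictField L ρ τ) * Q⁻¹ ∈
                    Serre1972.diagonalSubgroup k) ∧
                ∃ τ : Field.absoluteGaloisGroup L,
                  ((Q * Matrix.GeneralLinearGroup.map f (FramedGaloisRep.restrictField L ρ τ) *
                      Q⁻¹ : GL (Fin 2) k) : Matrix (Fin 2) (Fin 2) k) 0 0 ≠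
                    ((Q * Matrix.GeneralLinearGroup.map f (FramedGaloisRep.restrictField L ρ τ) *
                      Q⁻¹ : GL (Fin 2) k) : Matrix (Fin 2) (Fin 2) k) 1 1) →
            (∃ (M : Type) (_ : Field M) (_ : Algebra F M),
                Module.finrank F M = 2 ∧ IsTotallyReal M ∧ Nonempty (M →ₐ[F] L)) →
            IsAutomorphicOfWeightZero E)
    (h15 : Box2022_theorem1_5_modular) : BoxQuartic :=
  BoxQuartic_of_Box2022_theorem1_1 (Box2022_theorem1_1_of_liftingTheorems h3 h4 hKal hT h15)

end Summit.Langlands.Langlands.Theorems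

end
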